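import Literature.NumberTheory.EllipticCurves.KleinFrickeLevelSevenJZero
import HarnessLib

/-!
# Crux `MazurKenkuBound` (stmt-ABC-15125), line `radius-lite` — stub `stub_kleinSevenRat`:
# Klein–Fricke at level `7` over `ℚ`, with no exception at `j = 0` (`computational`)

The registered stub `stub_kleinSevenRat` of the line's skeleton (`Cruxes/MazurKenkuBound/Lines/
radius_lite.lean`, lead c22 reshape #2): an elliptic curve over `ℚ` admitting a rational isogeny of
degree `7` has `j = (t² + 13t + 49)(t² + 5t + 1)³/t` for some `t ∈ ℚˣ`. It is the conjunction of two
tree theorems — `Isogeny.exists_j_eq_klein_seven_of_degree_eq_seven` (`KleinFrickeLevelSeven.lean`,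
hypothesis `j ≠ 0`) and `Isogeny.j_ne_zero_of_degree_eq_seven_rat`
(`KleinFrickeLevelSevenJZero.lean`: no rational `7`-isogeny at `j = 0`) — and is `computational`
exactly as they are (both rest on the `native_decide` certificates `gamma7_cert`, `gamma7b_cert`),
which is why the kernel-closed skeleton registry displays it as a stub. It is the only input of
the proved level `21` of Kenku's table (`levelTwentyOne_jTable` in the skeleton) that is not
kernel-closed.

## References

* [Kenku1982] M. A. Kenku, J. Number Theory 15 (1982) 199–202, proof of Thm. 1, case (c), `N' = 7`.
* [SilvermanAEC2009] J. H. Silverman, *The Arithmetic of Elliptic Curves*, 2nd ed., III.4.12.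
-/

-- `Summit.ABC.ABC` is the mandated summit-side namespace (CONVENTIONS §2); the duplicate is deliberate.
set_option linter.dupNamespace false

noncomputable section

open WeierstrassCurve

namespace Summit.ABC.ABC.Theorems

/-- **STUB `stub_kleinSevenRat`: Klein–Fricke at level `7` over `ℚ`** — an elliptic curve over `ℚ`
with a rational isogeny of degree `7` has `j = (t² + 13t + 49)(t² + 5t + 1)³/t` for some
`t ∈ ℚˣ`; at `j ≠ 0` this is the tree's Klein–Fricke theorem, and `j = 0` does not occur
(`Isogeny.j_ne_zero_of_degree_eq_seven_rat`). `computational` (certificates `gamma7_cert`,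
`gamma7b_cert`). [cite: Kenku1982, proof of Thm. 1, p. 201] [cite: SilvermanAEC2009, III.4.12] -/
theorem stub_kleinSevenRat :
    ∀ (W W' : WeierstrassCurve ℚ) [W.IsElliptic] (φ : Isogeny W W'), φ.degree = 7 →
      ∃ t : ℚ, t ≠ 0 ∧ W.j = (t ^ 2 + 13 * t + 49) * (t ^ 2 + 5 * t + 1) ^ 3 / t := by
  intro W W' _ φ hdeg
  exact φ.exists_j_eq_klein_seven_of_degree_eq_seven hdeg (φ.j_ne_zero_of_degree_eq_seven_rat hdeg)

end Summit.ABC.ABC.Theorems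

end
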